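import Literature.NumberTheory.LFunctions.WeilTwoPrimeOddMarginEBase
import Literature.NumberTheory.LFunctions.WeilTwoPrimeOddMarginEDataDn2
import Literature.NumberTheory.LFunctions.WeilBlockRowsPZ
import HarnessLib

/-!
# Two-prime odd-margin certificate E: the Bessel block claim `Hp = C H Cᵀ`, rows 10–14

`WeilCert.checkHpRow` for rows 10–14 of certificate E (the exact Legendre cancellation `C H Cᵀ = diag(2a₀/(4i+3))`), by `decide +kernel`. Pure proof file.
-/

noncomputable section

namespace Literature.NumberTheory.LFunctions

set_option maxHeartbeats 0 in
/-- Row 10 of `C H Cᵀ` is row 10 of `Hp` (certificate E). [folklore] -/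
theorem checkHpRow1_10_weilCert23E : weilCert23EBase.checkHpRow weilCert23EHp 1 10 = true := by
  decide +kernel

set_option maxHeartbeats 0 in
/-- Row 11 of `C H Cᵀ` is row 11 of `Hp` (certificate E). [folklore] -/
theorem checkHpRow1_11_weilCert23E : weilCert23EBase.checkHpRow weilCert23EHp 1 11 = true := by
  decide +kernel

set_option maxHeartbeats 0 in
/-- Row 12 of `C H Cᵀ` is row 12 of `Hp` (certificate E). [folklore] -/
theorem checkHpRow1_12_weilCert23E : weilCert23EBase.checkHpRow weilCert23EHp 1 12 = true := by
  decide +kernel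

set_option maxHeartbeats 0 in
/-- Row 13 of `C H Cᵀ` is row 13 of `Hp` (certificate E). [folklore] -/
theorem checkHpRow1_13_weilCert23E : weilCert23EBase.checkHpRow weilCert23EHp 1 13 = true := by
  decide +kernel

set_option maxHeartbeats 0 in
/-- Row 14 of `C H Cᵀ` is row 14 of `Hp` (certificate E). [folklore] -/
theorem checkHpRow1_14_weilCert23E : weilCert23EBase.checkHpRow weilCert23EHp 1 14 = true := by
  decide +kernel


end Literature.NumberTheory.LFunctions
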